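import Summits.ResolutionOfSingularities.ResolutionOfSingularities.Theorems.FrobeniusLadderFInjectiveMacaulayficationDominatingLocFixRegular
import Literature.AlgebraicGeometry.Resolution.NonPrincipalLocus
import HarnessLib

/-!
# Product-compatible one-blowing-up resolution WITH SUPPORT CONTROL: `supp 𝔟 ⊆ Sing S ∪ NonPrinc J`
# (crux `FInjectiveMacaulayfication` stmt-ResolutionOfSingularities-15315, chain w45a; res-L1-w45a-plan-1 R16.43 (b1) sharpened as asked by
# res-L1-w45a-tri-2 21:58:16Z (iv) «ADD the support clause `supp 𝔟 ⊆ (Reg S)ᶜ ∪ NonInv(J)`»; seat res-L1-w45a-stub-1 g6)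

[OURS · L1 W4.5a] Support file (`--supports stmt-ResolutionOfSingularities-15315 --as helper`); NOT a statement of any manuscript; def-free;
THEOREMS modulo `CossartPiltant2019General` + `Stacks081R` + `CossartPiltant2019Principalization` BY NAME; AI-written (AI review is weaker
than expert review).

* `exists_isBlowup_supported_nonPrincipal`: a Cossart–Piltant sequence of blowing ups along regular centres (`IsRegularCentreBlowupSeq σ J`,
  Noetherian base) is ONE blowing up along an ideal sheaf supported in the NON-LOCALLY-PRINCIPAL locus `{s | ¬ IsLocallyPrincipalAt J s}`
  of `J` (sharper than the tree's `IsRegularCentreBlowupSeq.exists_isBlowup_supported`, which only records `⊆ supp J`): each centre lies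
  in the non-principal locus of the transform `J𝒪`, which maps into that of `J` (`IsLocallyPrincipalAt.comap`); Stacks 080B keeps supports.
* `exists_isBlowup_mul_isRegular_of_dim_three_supported (hG h081R hP)`: `DominatingLocFixRegular.exists_isBlowup_mul_isRegular_of_dim_three`
  with the extra clause `supp 𝔟 ⊆ (Reg S)ᶜ ∪ {s | ¬ IsLocallyPrincipalAt J s}` — the one-blowing-up resolution is an isomorphism over
  `Reg S`, the principalization centres lie over `NonPrinc J`, and the composite presentation (080B) is taken in its supported form. WHY
  (tri-2): with it the junk region of a cluster-growth step `J₀ ↦ J₀ · J″` is EXPLICIT — `supp J″` can be kept inside the closure of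
  `Sing X₁ ∪ NonPrinc J₀` (res-L1-w45a-stub-2's `exists_spread_support_subset`).
* `…_supported'`: the same clause in the STALK reading `{s | ¬ (J_s).IsPrincipal}` (`isLocallyPrincipalAt_iff_isPrincipal_stalkIdeal`).
[cite: CossartPiltant2019, Thm. 1.1 (i)(ii); Prop. 4.4] [cite: StacksProject, Tag 080A; Tag 080B] [cite: CossartPiltant2008, Prop. 4.2 (i)]
-/

-- single-problem summit: the doubled namespace component is forced
set_option linter.dupNamespace false

noncomputable section

namespace Summit.ResolutionOfSingularities.ResolutionOfSingularities.Theorems.FInjectiveMacaulayfication.DominatingLocFixRegularSupported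

open CategoryTheory CategoryTheory.Limits AlgebraicGeometry TopologicalSpace IsLocalRing
open Literature.AlgebraicGeometry.Resolution Literature.AlgebraicGeometry.CossartPiltant200819
open Scheme.IdealSheafData

universe u

/-- **A Cossart–Piltant sequence is one blowing up supported in the non-locally-principal locus of `J`.** [folklore; Stacks 080B iterated]
[cite: StacksProject, Tag 080B] [cite: CossartPiltant2019, Prop. 4.4 (i)] -/
theorem exists_isBlowup_supported_nonPrincipal :
    ∀ {S' S : Scheme.{u}} {σ : S' ⟶ S} {J : S.IdealSheafData}, IsRegularCentreBlowupSeq σ J →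
      IsNoetherian S →
        ∃ K : S.IdealSheafData, IsBlowup σ K ∧ (K.support : Set S) ⊆ {s | ¬ IsLocallyPrincipalAt J s} := by
  intro S' S σ J h
  induction h with
  | nil J => exact fun _ => ⟨⊤, isBlowup_id_top _, by simp⟩
  | @cons S'' S' S τ σ J Y hσ hYint hYreg hY hτ ih =>
    intro hN
    haveI := hN
    obtain ⟨K, hK, hKJ⟩ := ih hN
    refine IsBlowup.exists_isBlowup_comp_supported σ K τ (vanishingIdeal Y)
      {s | ¬ IsLocallyPrincipalAt J s} hK hKJ hτ ?_
    intro y hy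
    rw [Scheme.IdealSheafData.coe_support_vanishingIdeal] at hy
    exact fun h => hY y hy (h.comap σ)

/-- **Product-compatible one-blowing-up resolution WITH SUPPORT CONTROL.** For an integral Noetherian separated quasi-excellent scheme `S`
of dimension `3` and ANY `J ≠ ⊥` there is `𝔟 ≠ ⊥` SUPPORTED IN `Sing S ∪ NonPrinc J` such that a blowing up along `J · 𝔟` exists and is
regular and every blowing up along `J · 𝔟` is regular — modulo CP 2019 Thm. 1.1, Raynaud–Gruson flattening and CP 2019 Prop. 4.4 BY NAME.
[OURS · conditional-result] [cite: CossartPiltant2019, Thm. 1.1 (i)(ii); Prop. 4.4] [cite: StacksProject, Tag 080A; Tag 080B] -/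
theorem exists_isBlowup_mul_isRegular_of_dim_three_supported
    (hG : CossartPiltant2019General.{u}) (h081R : Stacks081R.{u}) (hP : CossartPiltant2019Principalization.{u})
    {S : Scheme.{u}} [IsIntegral S] [IsNoetherian S] [S.IsSeparated]
    (hqe : Scheme.IsQuasiExcellent S) (hdim : topologicalKrullDim S = 3)
    (J : S.IdealSheafData) (hJ : J ≠ ⊥) :
    ∃ 𝔟 : S.IdealSheafData, 𝔟 ≠ ⊥ ∧ (𝔟.support : Set S) ⊆ (Scheme.regularLocus S)ᶜ ∪ {s | ¬ IsLocallyPrincipalAt J s} ∧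
      (∃ (T : Scheme.{u}) (π : T ⟶ S), IsBlowup π (J * 𝔟) ∧ Scheme.IsRegular T) ∧
      ∀ (T : Scheme.{u}) (π : T ⟶ S), IsBlowup π (J * 𝔟) → Scheme.IsRegular T := by
  classical
  -- (1) the one-blowing-up resolution `ρ : T → S` along `𝓛`, an isomorphism over `U = Reg S`
  obtain ⟨𝓛, T, ρ, h𝓛, hρ, hTreg, U, hU, h𝓛U, hisoU⟩ :=
    CP2019.exists_isBlowup_isRegular_of_dim_three_of_isQuasiExcellent hG h081R hP hqe hdim
  haveI := hisoU
  haveI : IsProper ρ := hρ.isProper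
  haveI : IsIntegral T := hρ.isIntegral h𝓛
  haveI : IsNoetherian T := by
    haveI : IsLocallyNoetherian T := LocallyOfFiniteType.isLocallyNoetherian ρ
    haveI : CompactSpace T := QuasiCompact.compactSpace_of_compactSpace ρ
    exact {}
  -- the generic point `ξ` is regular and lies off `supp J` (`J_ξ ≠ 0` is an ideal of the function field, so `J_ξ = ⊤`)
  have hξU : genericPoint S ∈ (U : Set S) := by
    rw [hU, Scheme.mem_regularLocus]
    exact inferInstanceAs (IsRegularLocalRing S.functionField)
  have hξJ : genericPoint S ∉ (J.support : Set S) := by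
    intro hmem
    have hne : stalkIdeal J (genericPoint S) ≠ ⊤ := (mem_support_iff_stalkIdeal_ne_top J _).mp hmem
    have hnb : stalkIdeal J (genericPoint S) ≠ ⊥ := stalkIdeal_ne_bot_of_ne_bot hJ _
    have key : ∀ I : Ideal S.functionField, I = ⊥ ∨ I = ⊤ := fun I => Ideal.eq_bot_or_top I
    rcases key (stalkIdeal J (genericPoint S)) with h | h
    · exact hnb h
    · exact hne h
  -- a point `x′ ∈ T` over `ξ`
  obtain ⟨x', hx'⟩ := (ConcreteCategory.bijective_of_isIso (ρ ∣_ U).base).2 ⟨genericPoint S, hξU⟩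
  have hρx' : ρ x'.1 = genericPoint S := by
    have h1 := congrArg Subtype.val hx'
    rwa [morphismRestrict_base_coe] at h1
  -- `J𝒪_T ≠ 0`
  have hJT : J.comap ρ ≠ ⊥ := by
    intro h0
    have hmem : x'.1 ∈ ((J.comap ρ).support : Set T) := by rw [h0, support_bot]; trivial
    rw [support_comap] at hmem
    have hmem' : ρ x'.1 ∈ (J.support : Set S) := hmem
    rw [hρx'] at hmem'
    exact hξJ hmem'
  -- (2) `T` is a regular excellent threefold; principalize `J𝒪_T` (CP Prop. 4.4)
  have hexc : Scheme.IsExcellent T :=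
    CP2019.isExcellent_of_isRegular_of_isQuasiExcellent hTreg (Scheme.IsQuasiExcellent.of_locallyOfFiniteType ρ hqe)
  have hbir : IsBirational ρ := by
    refine isBirational_of_isIso_restrict ρ U (by rw [hU]) ?_
    refine (ρ ⁻¹ᵁ U).isOpen.dense ⟨x'.1, ?_⟩
    show ρ x'.1 ∈ (U : Set S)
    rw [hρx']
    exact hξU
  have hdimT : topologicalKrullDim T = 3 := hbir.topologicalKrullDim_eq_of_isProper.trans hdim
  obtain ⟨T', σ, hseq, hprinc⟩ := hP T hTreg hexc hdimT (J.comap ρ) hJT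
  haveI : IsIntegral T' := hseq.isIntegral hJT
  have hT'reg : Scheme.IsRegular T' := hseq.isRegular hTreg
  have hcart : IsEffectiveCartier (J.comap (σ ≫ ρ)) := by
    rw [comap_comp]
    exact hprinc.isEffectiveCartier_of_ne_bot (hseq.isIntegral_and_comap_ne_bot inferInstance inferInstance hJT).2.2
  -- (3) `σ` is one blowing up along some `𝓚 ⊆ V(J𝒪_T)`; `σ ≫ ρ` is one blowing up of `S` along some `Q` supported off `ξ`
  obtain ⟨𝓚, h𝓚, h𝓚supp⟩ := exists_isBlowup_supported_nonPrincipal hseq inferInstance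
  -- supports: `supp 𝓛 ⊆ Sing S`, `supp 𝓚 ⊆ NonPrinc (J𝒪_T) ⊆ ρ⁻¹ NonPrinc J`
  have h𝓛C : (𝓛.support : Set S) ⊆ (Scheme.regularLocus S)ᶜ ∪ {s | ¬ IsLocallyPrincipalAt J s} := by
    intro x hx
    refine Or.inl ?_
    rw [← hU]
    exact h𝓛U hx
  have h𝓚C : (𝓚.support : Set T) ⊆ ρ ⁻¹' ((Scheme.regularLocus S)ᶜ ∪ {s | ¬ IsLocallyPrincipalAt J s}) :=
    fun y hy => Or.inr fun h => h𝓚supp hy (h.comap ρ)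
  obtain ⟨Q, hQ, hQsupp⟩ :=
    IsBlowup.exists_isBlowup_comp_supported ρ 𝓛 σ 𝓚 ((Scheme.regularLocus S)ᶜ ∪ {s | ¬ IsLocallyPrincipalAt J s}) hρ h𝓛C h𝓚 h𝓚C
  -- `Q ≠ ⊥`: the generic point is regular and `J` is locally principal there (off `supp J`)
  have hQ0 : Q ≠ ⊥ := by
    intro h0
    have hmem : genericPoint S ∈ (Q.support : Set S) := by rw [h0, support_bot]; trivial
    rcases hQsupp hmem with h | h
    · apply h
      rw [← hU]
      exact hξU
    · exact h (isLocallyPrincipalAt_of_not_mem_support hξJ)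
  -- (4) `J𝒪_{T′}` is Cartier, so `σ ≫ ρ` is also THE blowing up along `Q · J = J · Q` (Stacks 080A with the identity blowing up)
  have hfin : IsBlowup (σ ≫ ρ) (J * Q) := by
    have h := hQ.comp (IsBlowup.id hcart)
    rw [Category.id_comp, mul_comm] at h
    exact h
  refine ⟨Q, hQ0, hQsupp, ⟨T', σ ≫ ρ, hfin, hT'reg⟩, fun T'' π'' hπ'' => ?_⟩
  obtain ⟨e, -, -⟩ := hfin.unique hπ''
  exact hT'reg.of_iso e.hom


/-- The same with the support clause in the STALK reading: `supp 𝔟 ⊆ Sing S ∪ {s | J_s is not principal}`. [plumbing]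
[cite: CossartPiltant2008, Prop. 4.2 (i)] -/
theorem exists_isBlowup_mul_isRegular_of_dim_three_supported'
    (hG : CossartPiltant2019General.{u}) (h081R : Stacks081R.{u}) (hP : CossartPiltant2019Principalization.{u})
    {S : Scheme.{u}} [IsIntegral S] [IsNoetherian S] [S.IsSeparated]
    (hqe : Scheme.IsQuasiExcellent S) (hdim : topologicalKrullDim S = 3)
    (J : S.IdealSheafData) (hJ : J ≠ ⊥) :
    ∃ 𝔟 : S.IdealSheafData, 𝔟 ≠ ⊥ ∧ (𝔟.support : Set S) ⊆ (Scheme.regularLocus S)ᶜ ∪ {s | ¬ (stalkIdeal J s).IsPrincipal} ∧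
      (∃ (T : Scheme.{u}) (π : T ⟶ S), IsBlowup π (J * 𝔟) ∧ Scheme.IsRegular T) ∧
      ∀ (T : Scheme.{u}) (π : T ⟶ S), IsBlowup π (J * 𝔟) → Scheme.IsRegular T := by
  obtain ⟨𝔟, h𝔟, hsupp, hex, hall⟩ := exists_isBlowup_mul_isRegular_of_dim_three_supported hG h081R hP hqe hdim J hJ
  refine ⟨𝔟, h𝔟, fun s hs => ?_, hex, hall⟩
  rcases hsupp hs with h | h
  · exact Or.inl h
  · exact Or.inr fun hp => h ((isLocallyPrincipalAt_iff_isPrincipal_stalkIdeal J s).mpr hp)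

end Summit.ResolutionOfSingularities.ResolutionOfSingularities.Theorems.FInjectiveMacaulayfication.DominatingLocFixRegularSupported

end
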